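/-
Origin: expansion seat `prover-pub-hodgecm-mc-binder-1-g6-0`, handover #1 12:00Z md5 b1286ac648f4 (267 l.; NEW additive KERNEL leaf, ns HodgeCM.Universe.ThetaModel + HodgeCM.Assembly; 2 defs (`ThetaModel.gen12Set` the generator set {ϑ₁₂(χ,Φ)}, structure `ThetaModel.Gen12SpanBridge` = `Gen12FunBridge` with `wf_gen` ↦ `wf_mem : wf ∈ closure (span gen12Set)`), 1 def-valued constructor `Gen12SpanBridge.ofFunBridge`, 10 theorems: `ϑ_mem_gen12Set`, **`gen12MeetAt_of_spanBridge`** (C5′ from the span bridge via the package's `StubTree.exists_inner_ne_zero_of_mem_closure_span`), `gen12MeetAt_of_nonempty_spanBridge`, `sum_smul_ϑ_mem_closure_span`, `Gen12SpanBridge.wf_mem_of_sum` (finite-sum constructor), **`nonempty_gen12FunBridge_of_gen12MeetAt`** (C5′ ⇒ the single-generator record BY CHOICE, given one `χ₀ : (T.t12 V c).X` and one `Φ₀ : T.SK V c`), **`nonempty_gen12FunBridge_iff`** (`Nonempty (T.Gen12FunBridge V c) ↔ T.Gen12MeetAt V c`), `nonempty_gen12FunBridge_of_spanBridge` (E's binder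 `gen12` from ANY span bridge), `nonempty_gen12SpanBridge_of_funBridge`, `AllCharsNonDesignPt₂.ofSpanBridges`, `Assembly.perL_ofSpanBridges₁₀`. 0 Prop defs, 0 records, 0 cited binders, nothing minted, MODEL-N ±0, E unchanged (0 binders). EVIDENCE (p-g11's RUN-35 in-place PKG world; the only import `Binders/MeetBridges.olean` is the run-32 artefact, untouched): private symlink-farm `lake env lean -o` rc 0 / 0 warnings / 0 errors in 7 s (`mc/pub-hodgecm-mc-binder-1-g6/farm/build-span.log`, olean 699032 B), `#print axioms` 11/11 = [propext, Classical.choice, Quot.sound] (`farm/ax_span.log`, probe `farm/ax_span.lean`), name-clash grep over PKG `HodgeCM/**` incl. Vendored = 0 hits for every new name, no `proof-hole`/`adm-token` token. INSTALL AS IS, any time (RUN 36).) (`HOME/mc/pub-hodgecm-mc-binder-1-g6/stage/HodgeCM/Model/Binders/MeetBridgesSpan.lean`, md5 b1286ac6, 267 lines);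
landed by the gen-12 packager (p-g12) in gate run 36 as `HodgeCM/Model/Binders/MeetBridgesSpan.lean` (verbatim).
-/
/-
Origin: speedrun cell pub-hodgecm, MODEL-CONSTRUCTION sub-cell, unit pub-hodgecm-mc-binder-1-g6 (BINDER PROVER hbr/hQ/hch,
gen 6; node B2-meet = rows gen12/real34 of the E term), seat prover-pub-hodgecm-mc-binder-1-g6-0, 2026-08-19.
Target in PKG: HodgeCM/Model/Binders/MeetBridgesSpan.lean (NEW additive leaf; imports `HodgeCM.Model.Binders.MeetBridges`
(binder-1-g2, gate run 32) only; nothing landed imports it).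
KERNEL ONLY: every declaration below is proved from the package as it stands; 0 records asserted, 0 cited hypotheses,
MODEL-N 0.  `#print axioms` of every theorem = [propext, Classical.choice, Quot.sound].
-/
import Summits.HodgeConjecture.HodgeCM.Model.Binders.MeetBridges

/-!
# B2-meet — the (12) bridge in SPAN form, and `Nonempty (Gen12FunBridge) ↔ Gen12MeetAt`

`Binders/MeetBridges.lean` (gen 2) split C5′ = `ThetaModel.Gen12MeetAt V c` into the function-level record
`Gen12FunBridge` whose field `wf_gen` asks that the GLOBAL wedge-function `wf Γ ω₁ ω₂` of two theta one-forms BE ONE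
model generator `(T.t12 V c).ϑ χ Φ`.

WHY A SPAN FORM.  At the pin of record (mc-theta-3 `Model/ThetaSpaceInputPin` + `Model/ThetaSpace`,
`Model/ThetaSideInstance.thetaOf`) the theta set `T.Theta V c k Γ` is the set of `(1,0)`-classes of the classical theta SPACE
`thetaSpaceOf (P k) … (P k).weightFunctions = ⨆_S (S.thetaForms 𝓕).map restrictHom`, and `thetaForms … 𝓙 𝓕` is the
`Submodule.span` of the theta forms `thetaForm j f` over ALL test families `j ∈ 𝓙` and ALL weight functions `f ∈ 𝓕` (all
characters `χ′` of `[U(W_k)]` of the archimedean type of the line).  A theta one-form is therefore the class of a FINITE SUM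
`Σᵢ θ(jᵢ, fᵢ)` with possibly DIFFERENT characters `fᵢ`, and the global wedge-function of two such classes is, by the see-saw
identity (tree `Weil1964/ThetaFormWedgePeriod`, `GelbartRogawski1991/UnitaryDualPairSeesawThetaPeriod`) applied term by term,
a finite sum `Σ_{i,j} ϑ(χᵢⱼ, Φᵢⱼ)` of generators against the product characters `χᵢⱼ = fᵢ ⊠ f′ⱼ` — an element of the SPAN of
the generators, not one generator (the character index `(T.t12 V c).X` is a single character of `[T]`).  PerL v5 itself applies
Lemma «seesaw» (tex ll. 318–326) to single theta series `θ(φ, χ′)` and Thm 4.4 Step 2 (ll. 700–712) only needs the wedge to have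
a non-zero component along `S₁₂ = closure (span {ϑ₁₂(χ, Φ)})` (ll. 348–349).

WHAT IS HERE (kernel, over an arbitrary theta model `T`):
* §1 `Gen12SpanBridge` — `Gen12FunBridge` with `wf_gen` replaced by **`wf_mem`**: `wf Γ ω₁ ω₂ ∈ closure (span {ϑ χ Φ})`
  (= PerL's `S₁₂` up to the `allowed` predicate, which the END STATE sets to `True`); `proj` verbatim.
  **`gen12MeetAt_of_spanBridge`**: C5′ from the span bridge (if `Λ ≠ 0` then `⟪Λ, wf⟫ = a‖Λ‖² ≠ 0`, so `Λ` is not orthogonal to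
  the closed span, hence pairs non-trivially with one generator — the package's Hilbert-space lemma
  `StubTree.exists_inner_ne_zero_of_mem_closure_span`).  `Gen12SpanBridge.ofFunBridge` (the old record is a special case),
  `Gen12SpanBridge.wf_mem_of_sum` (constructor of `wf_mem` from a finite-sum shape — what the see-saw identity delivers at the pin).
* §2 **`nonempty_gen12FunBridge_of_gen12MeetAt`** and **`nonempty_gen12FunBridge_iff`**: given one character index and one
  Schwartz index (both exist at the pin: `SeesawTorus.nonempty_allowedChars`, `WmInput.SK_zero`), `Nonempty (T.Gen12FunBridge V c)`
  is EQUIVALENT to `T.Gen12MeetAt V c` — the record is C5′ itself, by choice (`wf :=` a generator pairing non-trivially with `Λ`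
  when `Λ ≠ 0`).  Hence `nonempty_gen12FunBridge_of_spanBridge`: the E binder `gen12 : … → Nonempty (T.Gen12FunBridge V c)` of
  `Model.perL_picardCM_r15A` / `_r17A` is discharged by ANY span bridge — no E revision is forced by this file.
* §3 `AllCharsNonDesignPt₂.ofSpanBridges`, `Assembly.perL_ofSpanBridges₁₀` — the six-input record and the ₁₀ headline over span
  bridges (mirror of `MeetBridges` §3).

CONSEQUENCE FOR THE INSTANCE (binder-1's RUN-36+ item «B2-meet INSTANCE (gen12 side)», desk (UUUU′)(3)): the natural value
`wf Γ ω₁ ω₂ :=` the global wedge-function of adelic theta forms representing `ω₁, ω₂` satisfies `wf_mem` (see-saw term by term +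
`wf_mem_of_sum`) and `proj` (piece projection / level-orbit unfolding); `Gen12FunBridge` then follows by §2.  Nothing here is a
hypothesis of PerL; nothing is cited.
-/

noncomputable section

open scoped InnerProductSpace

namespace HodgeCM

open HodgeCM.Prior.Perl34File

namespace Universe

namespace ThetaModel

variable {U : Universe} (T : U.ThetaModel)

/-! ## 1. The (12) bridge in span form -/

/-- The set of (12)-model generators `ϑ₁₂(χ, Φ)` at `(V, c)` (the generating set of PerL's `S₁₂`, tex ll. 348–349, with every
character of the type allowed). -/
def gen12Set {L : CMField} {ι₁ : L →+* ℂ} (V : HermSpace3 L ι₁) (c : SeesawCtx L) : Set (T.HG L ι₁ V) :=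
  {u | ∃ (χ : (T.t12 V c).X) (Φ : T.SK V c), u = (T.t12 V c).ϑ χ Φ}

/-- (Ported verbatim from the HodgeCMPerL package; no docstring in the source.) -/
theorem ϑ_mem_gen12Set {L : CMField} {ι₁ : L →+* ℂ} (V : HermSpace3 L ι₁) (c : SeesawCtx L) (χ : (T.t12 V c).X)
    (Φ : T.SK V c) : (T.t12 V c).ϑ χ Φ ∈ T.gen12Set V c :=
  ⟨χ, Φ, rfl⟩

/-- **Function-level (12)-bridge at `(V, c)`, SPAN FORM** (row hbr / E binder `gen12`).  Data: the global wedge-function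
`wf Γ ω₁ ω₂ ∈ HG`.  Obligations, for theta one-forms `ω₁ ∈ Θ₀(Γ)`, `ω₂ ∈ Θ₁(Γ)`: `wf_mem` — the global wedge-function lies
in the CLOSED SPAN of the (12)-theta lifts (SEESAW term by term: each wedge of single theta series is one lift, PerL (eq:seesaw);
sums of theta series give sums of lifts); `proj` — the model's wedge-function `Λ_Γ(ω₁, ω₂)` pairs with it as a non-zero
multiple of `⟪Λ, Λ⟫` (PIECE PROJECTION / unfolding).  Values of `wf` off theta one-forms are irrelevant. -/
structure Gen12SpanBridge {L : CMField} {ι₁ : L →+* ℂ} (V : HermSpace3 L ι₁) (c : SeesawCtx L) where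
  /-- the global (12)-wedge-function of two degree-one classes at level `Γ` -/
  wf : ∀ Γ : Level V, U.CohC (U.pms L ι₁ V Γ) 1 → U.CohC (U.pms L ι₁ V Γ) 1 → T.HG L ι₁ V
  /-- SEESAW, span form: for theta one-forms the global wedge-function lies in the closed span of the (12)-theta lifts -/
  wf_mem : ∀ (Γ : Level V) (ω₁ ω₂ : U.CohC (U.pms L ι₁ V Γ) 1), ω₁ ∈ T.Theta V c 0 Γ → ω₂ ∈ T.Theta V c 1 Γ →
    wf Γ ω₁ ω₂ ∈ (Submodule.span ℂ (T.gen12Set V c)).topologicalClosure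
  /-- PIECE PROJECTION: `⟪Λ_Γ(ω₁, ω₂), wf⟫ = a · ⟪Λ_Γ(ω₁, ω₂), Λ_Γ(ω₁, ω₂)⟫` for some `a ≠ 0` -/
  proj : ∀ (Γ : Level V) (ω₁ ω₂ : U.CohC (U.pms L ι₁ V Γ) 1), ω₁ ∈ T.Theta V c 0 Γ → ω₂ ∈ T.Theta V c 1 Γ →
    ∃ a : ℂ, a ≠ 0 ∧ ⟪T.Λ Γ ω₁ ω₂, wf Γ ω₁ ω₂⟫_ℂ = a * ⟪T.Λ Γ ω₁ ω₂, T.Λ Γ ω₁ ω₂⟫_ℂ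

/-- **C5′ from the span bridge**: a non-zero wedge of theta one-forms pairs non-trivially with its global wedge-function
(`proj`), which lies in the closed span of the (12)-theta lifts (`wf_mem`), hence pairs non-trivially with ONE of them. -/
theorem gen12MeetAt_of_spanBridge {L : CMField} {ι₁ : L →+* ℂ} {V : HermSpace3 L ι₁} {c : SeesawCtx L}
    (B : T.Gen12SpanBridge V c) : T.Gen12MeetAt V c := by
  intro Γ ω₁ ω₂ h₁ h₂ hne
  obtain ⟨a, ha, hproj⟩ := B.proj Γ ω₁ ω₂ h₁ h₂
  have hΛ : ⟪T.Λ Γ ω₁ ω₂, B.wf Γ ω₁ ω₂⟫_ℂ ≠ 0 := by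
    rw [hproj]
    exact mul_ne_zero ha (inner_self_ne_zero.mpr hne)
  obtain ⟨u, ⟨χ, Φ, rfl⟩, hu⟩ := StubTree.exists_inner_ne_zero_of_mem_closure_span hΛ (B.wf_mem Γ ω₁ ω₂ h₁ h₂)
  exact ⟨χ, Φ, hu⟩

/-- `Nonempty` form of `gen12MeetAt_of_spanBridge`. -/
theorem gen12MeetAt_of_nonempty_spanBridge {L : CMField} {ι₁ : L →+* ℂ} {V : HermSpace3 L ι₁} {c : SeesawCtx L}
    (h : Nonempty (T.Gen12SpanBridge V c)) : T.Gen12MeetAt V c :=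
  h.elim fun B => T.gen12MeetAt_of_spanBridge B

/-- **The single-generator record is a span bridge** (`ϑ χ Φ ∈ span ⊆ closure`). -/
def Gen12SpanBridge.ofFunBridge {L : CMField} {ι₁ : L →+* ℂ} {V : HermSpace3 L ι₁} {c : SeesawCtx L}
    (B : T.Gen12FunBridge V c) : T.Gen12SpanBridge V c where
  wf := B.wf
  wf_mem Γ ω₁ ω₂ h₁ h₂ := by
    obtain ⟨χ, Φ, h⟩ := B.wf_gen Γ ω₁ ω₂ h₁ h₂
    exact (Submodule.span ℂ (T.gen12Set V c)).le_topologicalClosure (Submodule.subset_span ⟨χ, Φ, h⟩)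
  proj := B.proj

/-- **Constructor of `wf_mem` from the finite-sum shape the see-saw identity delivers**: a finite linear combination of
generators lies in the closed span. -/
theorem sum_smul_ϑ_mem_closure_span {L : CMField} {ι₁ : L →+* ℂ} (V : HermSpace3 L ι₁) (c : SeesawCtx L)
    {ι : Type*} (s : Finset ι) (a : ι → ℂ) (χ : ι → (T.t12 V c).X) (Φ : ι → T.SK V c) :
    (∑ i ∈ s, a i • (T.t12 V c).ϑ (χ i) (Φ i)) ∈ (Submodule.span ℂ (T.gen12Set V c)).topologicalClosure :=
  (Submodule.span ℂ (T.gen12Set V c)).le_topologicalClosure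
    (Submodule.sum_mem _ fun i _ => Submodule.smul_mem _ (a i) (Submodule.subset_span (T.ϑ_mem_gen12Set V c (χ i) (Φ i))))

/-- `wf_mem` from a finite-sum shape: if for theta one-forms `wf Γ ω₁ ω₂ = Σᵢ aᵢ • ϑ(χᵢ, Φᵢ)`, then `wf_mem` holds. -/
theorem Gen12SpanBridge.wf_mem_of_sum {L : CMField} {ι₁ : L →+* ℂ} {V : HermSpace3 L ι₁} {c : SeesawCtx L}
    (wf : ∀ Γ : Level V, U.CohC (U.pms L ι₁ V Γ) 1 → U.CohC (U.pms L ι₁ V Γ) 1 → T.HG L ι₁ V)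
    (h : ∀ (Γ : Level V) (ω₁ ω₂ : U.CohC (U.pms L ι₁ V Γ) 1), ω₁ ∈ T.Theta V c 0 Γ → ω₂ ∈ T.Theta V c 1 Γ →
      ∃ (n : ℕ) (a : Fin n → ℂ) (χ : Fin n → (T.t12 V c).X) (Φ : Fin n → T.SK V c),
        wf Γ ω₁ ω₂ = ∑ i, a i • (T.t12 V c).ϑ (χ i) (Φ i)) :
    ∀ (Γ : Level V) (ω₁ ω₂ : U.CohC (U.pms L ι₁ V Γ) 1), ω₁ ∈ T.Theta V c 0 Γ → ω₂ ∈ T.Theta V c 1 Γ →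
      wf Γ ω₁ ω₂ ∈ (Submodule.span ℂ (T.gen12Set V c)).topologicalClosure := by
  intro Γ ω₁ ω₂ h₁ h₂
  obtain ⟨n, a, χ, Φ, hwf⟩ := h Γ ω₁ ω₂ h₁ h₂
  rw [hwf]
  exact T.sum_smul_ϑ_mem_closure_span V c Finset.univ a χ Φ

/-! ## 2. `Nonempty (Gen12FunBridge)` is C5′ itself -/

/-- **C5′ gives the single-generator record, by choice**: `wf Γ ω₁ ω₂ :=` a generator `ϑ χ Φ` pairing non-trivially with
`Λ_Γ(ω₁, ω₂)` when the wedge is non-zero (such a generator exists by `Gen12MeetAt`), and a fixed generator `ϑ χ₀ Φ₀`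
otherwise; `proj` with `a := ⟪Λ, wf⟫ / ⟪Λ, Λ⟫`.  Needs ONE character index `χ₀` and ONE Schwartz index `Φ₀` (at the pin:
`SeesawTorus.nonempty_allowedChars`, `0 ∈ 𝒮^κ`). -/
theorem nonempty_gen12FunBridge_of_gen12MeetAt {L : CMField} {ι₁ : L →+* ℂ} {V : HermSpace3 L ι₁} {c : SeesawCtx L}
    (χ₀ : (T.t12 V c).X) (Φ₀ : T.SK V c) (h : T.Gen12MeetAt V c) : Nonempty (T.Gen12FunBridge V c) := by
  classical
  -- the chosen generator on non-zero wedges of theta one-forms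
  have key : ∀ (Γ : Level V) (ω₁ ω₂ : U.CohC (U.pms L ι₁ V Γ) 1),
      ω₁ ∈ T.Theta V c 0 Γ ∧ ω₂ ∈ T.Theta V c 1 Γ ∧ T.Λ Γ ω₁ ω₂ ≠ 0 →
        ∃ (χ : (T.t12 V c).X) (Φ : T.SK V c), ⟪T.Λ Γ ω₁ ω₂, (T.t12 V c).ϑ χ Φ⟫_ℂ ≠ 0 :=
    fun Γ ω₁ ω₂ hh => h Γ ω₁ ω₂ hh.1 hh.2.1 hh.2.2
  refine ⟨{ wf := fun Γ ω₁ ω₂ =>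
              if hh : ω₁ ∈ T.Theta V c 0 Γ ∧ ω₂ ∈ T.Theta V c 1 Γ ∧ T.Λ Γ ω₁ ω₂ ≠ 0 then
                (T.t12 V c).ϑ (key Γ ω₁ ω₂ hh).choose (key Γ ω₁ ω₂ hh).choose_spec.choose
              else (T.t12 V c).ϑ χ₀ Φ₀,
            wf_gen := ?_, proj := ?_ }⟩
  · intro Γ ω₁ ω₂ h₁ h₂
    by_cases hne : T.Λ Γ ω₁ ω₂ ≠ 0
    · refine ⟨(key Γ ω₁ ω₂ ⟨h₁, h₂, hne⟩).choose, (key Γ ω₁ ω₂ ⟨h₁, h₂, hne⟩).choose_spec.choose, ?_⟩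
      simp only [dif_pos (And.intro h₁ (And.intro h₂ hne))]
    · exact ⟨χ₀, Φ₀, by
        simp only [dif_neg (fun hh : ω₁ ∈ T.Theta V c 0 Γ ∧ ω₂ ∈ T.Theta V c 1 Γ ∧ T.Λ Γ ω₁ ω₂ ≠ 0 => hne hh.2.2)]⟩
  · intro Γ ω₁ ω₂ h₁ h₂
    by_cases hne : T.Λ Γ ω₁ ω₂ ≠ 0
    · have hsel := (key Γ ω₁ ω₂ ⟨h₁, h₂, hne⟩).choose_spec.choose_spec
      have hΛΛ : ⟪T.Λ Γ ω₁ ω₂, T.Λ Γ ω₁ ω₂⟫_ℂ ≠ 0 := inner_self_ne_zero.mpr hne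
      refine ⟨⟪T.Λ Γ ω₁ ω₂, (T.t12 V c).ϑ (key Γ ω₁ ω₂ ⟨h₁, h₂, hne⟩).choose
          (key Γ ω₁ ω₂ ⟨h₁, h₂, hne⟩).choose_spec.choose⟫_ℂ / ⟪T.Λ Γ ω₁ ω₂, T.Λ Γ ω₁ ω₂⟫_ℂ,
        div_ne_zero hsel hΛΛ, ?_⟩
      simp only [dif_pos (And.intro h₁ (And.intro h₂ hne))]
      exact (div_mul_cancel₀ _ hΛΛ).symm
    · refine ⟨1, one_ne_zero, ?_⟩
      have h0 : T.Λ Γ ω₁ ω₂ = 0 := not_not.mp hne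
      simp only [dif_neg (fun hh : ω₁ ∈ T.Theta V c 0 Γ ∧ ω₂ ∈ T.Theta V c 1 Γ ∧ T.Λ Γ ω₁ ω₂ ≠ 0 => hne hh.2.2)]
      rw [h0, inner_zero_left, inner_zero_left, mul_zero]

/-- **`Nonempty (T.Gen12FunBridge V c) ↔ T.Gen12MeetAt V c`** (given one character index and one Schwartz index). -/
theorem nonempty_gen12FunBridge_iff {L : CMField} {ι₁ : L →+* ℂ} {V : HermSpace3 L ι₁} {c : SeesawCtx L}
    (χ₀ : (T.t12 V c).X) (Φ₀ : T.SK V c) : Nonempty (T.Gen12FunBridge V c) ↔ T.Gen12MeetAt V c :=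
  ⟨T.gen12MeetAt_of_nonempty_funBridge, T.nonempty_gen12FunBridge_of_gen12MeetAt χ₀ Φ₀⟩

/-- **The E binder `gen12` from a span bridge** (what the instance delivers): `Nonempty (T.Gen12FunBridge V c)` from any
`Gen12SpanBridge`, given one character index and one Schwartz index. -/
theorem nonempty_gen12FunBridge_of_spanBridge {L : CMField} {ι₁ : L →+* ℂ} {V : HermSpace3 L ι₁} {c : SeesawCtx L}
    (χ₀ : (T.t12 V c).X) (Φ₀ : T.SK V c) (B : T.Gen12SpanBridge V c) : Nonempty (T.Gen12FunBridge V c) :=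
  T.nonempty_gen12FunBridge_of_gen12MeetAt χ₀ Φ₀ (T.gen12MeetAt_of_spanBridge B)

/-- Conversely a `Gen12FunBridge` gives a span bridge outright (`Nonempty` form). -/
theorem nonempty_gen12SpanBridge_of_funBridge {L : CMField} {ι₁ : L →+* ℂ} {V : HermSpace3 L ι₁} {c : SeesawCtx L}
    (h : Nonempty (T.Gen12FunBridge V c)) : Nonempty (T.Gen12SpanBridge V c) :=
  h.map (Gen12SpanBridge.ofFunBridge T)

/-! ## 3. The six-input record and the headline over span bridges -/

variable {T}

/-- **`AllCharsNonDesignPt₂ S` from C2, C3, C4, C7, a (12) SPAN bridge and a (34) function-level bridge** (each demanded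
only at good contexts of the class `S`). -/
theorem AllCharsNonDesignPt₂.ofSpanBridges {S : ∀ {L : CMField}, SeesawCtx L → Prop}
    (innerEmb : ∀ {L : CMField} {ι₁ : L →+* ℂ} (V : HermSpace3 L ι₁) (c : SeesawCtx L),
      T.GoodCtx ι₁ c → S c → T.InnerEmbAt V)
    (thetaSub : ∀ {L : CMField} {ι₁ : L →+* ℂ} (V : HermSpace3 L ι₁) (c : SeesawCtx L), T.GoodCtx ι₁ c → S c →
      ∀ (i : Fin 4) (Γ : Level V), T.Theta V c i Γ ⊆ U.Uiso Γ c.K (c.Ψ i) c.σ)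
    (thetaWedge : ∀ {L : CMField} {ι₁ : L →+* ℂ} (V : HermSpace3 L ι₁) (c : SeesawCtx L), T.GoodCtx ι₁ c → S c →
      ∃ Γ : Level V, ∃ ω₁ ∈ T.Theta V c 0 Γ, ∃ ω₂ ∈ T.Theta V c 1 Γ, U.cup2C (U.pms L ι₁ V Γ) 1 ω₁ ω₂ ≠ 0)
    (gen12 : ∀ {L : CMField} {ι₁ : L →+* ℂ} (V : HermSpace3 L ι₁) (c : SeesawCtx L), T.GoodCtx ι₁ c → S c →
      Nonempty (T.Gen12SpanBridge V c))
    (real34 : ∀ {L : CMField} {ι₁ : L →+* ℂ} (V : HermSpace3 L ι₁) (c : SeesawCtx L), T.GoodCtx ι₁ c → S c →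
      Nonempty (T.Real34FunBridge V c))
    (occ : ∀ {L : CMField} {ι₁ : L →+* ℂ} (V : HermSpace3 L ι₁) (c : SeesawCtx L), T.GoodCtx ι₁ c → S c →
      (∀ (Φ : T.SK V c) (i : T.SigIdx V c),
          (∃ v ∈ (T.core V c).hatσ i, (T.core V c).TΦ Φ v ≠ 0) → (T.t12 V c).wOccurs i) ∧
        (∀ (Φ : T.SK V c) (i : T.SigIdx V c),
          (∃ v ∈ (T.core V c).hatσ i, (T.core V c).TΦ Φ v ≠ 0) → (T.t34 V c).wOccurs i)) :
    T.AllCharsNonDesignPt₂ S :=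
  ⟨innerEmb, thetaSub, thetaWedge,
    fun V c hc hS => T.gen12MeetAt_of_nonempty_spanBridge (gen12 V c hc hS),
    fun V c hc hS => T.real34MeetAt_of_nonempty_funBridge (real34 V c hc hS),
    occ⟩

end ThetaModel

end Universe

/-! ### Headline over the span bridge -/

namespace Assembly

open HodgeCM.Universe (AdelicThetaCore₀ SideData ThetaModel ModelAxiomsPerL)

variable (U : Universe)

/-- **₁₀ over the (12) SPAN bridge and the (34) function-level bridge**: `perL_ofSignRecipe₁₀` with
`AllCharsNonDesignPt₂.ofSpanBridges`. -/
theorem perL_ofSpanBridges₁₀ (M : U.ModelAxiomsPerL) (h : Bool) (C : U.AdelicThetaCore₀)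
    (d12 d34 : ∀ {L : CMField}, SeesawCtx L → SideData L) {S : ∀ {L : CMField}, SeesawCtx L → Prop}
    (hS : ∀ {L : CMField} (c : SeesawCtx L), Module.finrank ℚ c.K = 6 → S c)
    (innerEmb : ∀ {L : CMField} {ι₁ : L →+* ℂ} (V : HermSpace3 L ι₁) (c : SeesawCtx L),
      (C.thetaModel h d12 d34).GoodCtx ι₁ c → S c → (C.thetaModel h d12 d34).InnerEmbAt V)
    (thetaSub : ∀ {L : CMField} {ι₁ : L →+* ℂ} (V : HermSpace3 L ι₁) (c : SeesawCtx L),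
      (C.thetaModel h d12 d34).GoodCtx ι₁ c → S c →
      ∀ (i : Fin 4) (Γ : Level V), (C.thetaModel h d12 d34).Theta V c i Γ ⊆ U.Uiso Γ c.K (c.Ψ i) c.σ)
    (thetaWedge : ∀ {L : CMField} {ι₁ : L →+* ℂ} (V : HermSpace3 L ι₁) (c : SeesawCtx L),
      (C.thetaModel h d12 d34).GoodCtx ι₁ c → S c →
      ∃ Γ : Level V, ∃ ω₁ ∈ (C.thetaModel h d12 d34).Theta V c 0 Γ,
        ∃ ω₂ ∈ (C.thetaModel h d12 d34).Theta V c 1 Γ, U.cup2C (U.pms L ι₁ V Γ) 1 ω₁ ω₂ ≠ 0)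
    (gen12 : ∀ {L : CMField} {ι₁ : L →+* ℂ} (V : HermSpace3 L ι₁) (c : SeesawCtx L),
      (C.thetaModel h d12 d34).GoodCtx ι₁ c → S c → Nonempty ((C.thetaModel h d12 d34).Gen12SpanBridge V c))
    (real34 : ∀ {L : CMField} {ι₁ : L →+* ℂ} (V : HermSpace3 L ι₁) (c : SeesawCtx L),
      (C.thetaModel h d12 d34).GoodCtx ι₁ c → S c → Nonempty ((C.thetaModel h d12 d34).Real34FunBridge V c))
    (occ : ∀ {L : CMField} {ι₁ : L →+* ℂ} (V : HermSpace3 L ι₁) (c : SeesawCtx L),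
      (C.thetaModel h d12 d34).GoodCtx ι₁ c → S c →
      (∀ (Φ : (C.thetaModel h d12 d34).SK V c) (i : (C.thetaModel h d12 d34).SigIdx V c),
          (∃ v ∈ ((C.thetaModel h d12 d34).core V c).hatσ i, ((C.thetaModel h d12 d34).core V c).TΦ Φ v ≠ 0) →
          ((C.thetaModel h d12 d34).t12 V c).wOccurs i) ∧
        (∀ (Φ : (C.thetaModel h d12 d34).SK V c) (i : (C.thetaModel h d12 d34).SigIdx V c),
          (∃ v ∈ ((C.thetaModel h d12 d34).core V c).hatσ i, ((C.thetaModel h d12 d34).core V c).TΦ Φ v ≠ 0) →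
          ((C.thetaModel h d12 d34).t34 V c).wOccurs i))
    (hHR : U.Fact_hodgeRiemann20) : U.PerL :=
  perL_ofSignRecipe₁₀ U M h C d12 d34 hS
    (ThetaModel.AllCharsNonDesignPt₂.ofSpanBridges innerEmb thetaSub thetaWedge gen12 real34 occ) hHR

end Assembly

end HodgeCM

end
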